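/-
Copyright: cell `pub-ymgap` (HUMAN RULING D-0062), Track A of `YM-PLAN.md`, DAG node N20 (= NE7b); R134 seat `pub-ymgap-dag-n20-d`
(strategy s3 «alternative currency», generation 7), module 14.  Released under the licence of the surrounding project.
-/
import Summits.QuantumFields.YangMills.Theorems.BalabanUVNodesN20ByValueMultiscalePeierls
import Summits.QuantumFields.YangMills.Theorems.BalabanUVNodesN20ByValueLabelTowerPinned
import HarnessLib

/-!
# YM-DAG node N20 (= NE7b), strategy s3, THE FOURTH CURRENCY «BY VALUE» (module 14): CELLS AT EVERY LEVEL, AND THE READING ON BAŁABAN's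
# LABEL TOWER OF RECORD — the class weight of a pattern pinning large-field cubes at ANY finite set of levels is at most the FULL PRODUCT of
# one Peierls factor per pinned cube of every pinned level times `∫ρ₀ dU₀`, UNCONDITIONALLY (no «LCS-k», no root, no (MSP) hypothesis),
# with level-dependent letters — module 11 §3's displayed conclusion with `m_j·r` replaced by `m_j·e^{v_{j+1}}·e^{−τ_{j+1} g₀⁻² ε_j²∕(2N)}`

Track A of `YM-PLAN.md` (cell `pub-ymgap`, HUMAN RULING D-0062), node **N20** = spine estimate NE7b (`T4WeightBudget.RelWeightBound` — the cell
`pub-balaban`'s OWN estimate, NOT PRINTED in [Bałaban 1983–89], NOT PROVED).  Seat `pub-ymgap-dag-n20-d` (R134, s3), generation 7, module 14 (modules 12 ∕ 13: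
`…N20ByValueMultiscaleTilt` — the joint multiscale exponential plaquette moment; `…N20ByValueMultiscalePeierls` — the product law without the root).
Kernel theorems only: 0 `def`, 0 `sorry`, standard axioms; COUNT-NEUTRAL (`--supports` K3⁗ `SpineGivenEndpointR13Sep`, stmt-QuantumFields-20292,
`--as helper`).  Restate-immune.  n20-c's label tower (`labelTowerOfRecord`, modules 27–33) and module 9's reduction are consumed BY NAME.

* §0 (generic) ★ **`measureReal_forall_exists_le_prod`** — WEIGHTED one-witness-per-cell counting (generation 3's `measureReal_forall_exists_le_pow` with
  per-witness weights `w p`, per-cell sizes `m c` and per-cell majorants `W c`): `μ{∀ c ∈ 𝒞, ∃ p ∈ cells c, E p} ≤ Π_{c∈𝒞}(m c·W c)` from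
  `μ(⋂_{p∈Y} E p) ≤ Π_{p∈Y} w p` for the sub-families `Y` of the cells' union (pairwise disjoint cells).
* §1 ★★★ **`gibbsMeasure_multiLevel_largeFieldCells_dist1_le_prod`** (CELLS AT EVERY LEVEL, on the bare field): with module 13's rates `τ_k > 0` and volume
  letters `v_k ≥ 0` (functions of `N`, `L`, `k`), for every finite family of pins `c ∈ 𝒞` with levels `ℓ c ≤ K`, witness sets `cells c ⊆ Plaq P (ℓ c)` of
  size `≤ m_{ℓ c}`, pairwise disjoint inside `Σ k, Plaq P k` (i.e. disjoint within each level), and thresholds `ε_k ≥ 0`,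
  `μ_β{U | ∀ c ∈ 𝒞, ∃ p ∈ cells c, ε_{ℓ c} ≤ |Ū^{ℓ c}U(∂p) − 1|} ≤ Π_{c∈𝒞} m_{ℓ c}·e^{v_{ℓ c}}·e^{−τ_{ℓ c} β ε_{ℓ c}²∕(2N)}`
  — ONE full Peierls factor per pinned cell of EVERY level (module 13 §3 on the level-indexed traces of a sub-family, re-indexed by `Finset.prod_sigma`).
* §2 ★★★ **`sum_admS_integral_le_labelTower_allLevels_byValue`** (ON BAŁABAN's LABEL TOWER OF RECORD, for NODE 00's `ρ₀ = rhoZeroOfRecord`): for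
  `g₀⁻² ≥ 4N`, the two ζ-laws, (O4), ANY finite set `J` of pinned levels `j < K_P` with families `D j` of χ_{j+1}-cubes, regularity letters on pairwise
  disjoint regions `R j c` of `≤ m_j` level-`(j+1)` plaquettes, thresholds `ε_j ≥ 0`, every cutoff `K′` and every label-family pattern pinning `D j` at the
  levels `j ∈ J` and free elsewhere:
  `Σ_{h ∈ admS (labelTowerOfRecord A₁ ζ) (labelPattern E) K′} ∫ eterm ρ₀ K′ h dμ_{K′} ≤
     (Π_{j∈J, j<K′} (m_j·e^{v_{j+1}}·e^{−τ_{j+1} g₀⁻² ε_j²∕(2N)})^{#D_j})·∫ρ₀ dU₀`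
  — module 11 §2 WITHOUT the `1∕#J`-th root and WITHOUT `J.Nonempty`; module 11 §3's conclusion SHAPE with the hypothesis (MSP) DISCHARGED in its
  level-DEPENDENT form.
WHAT REMAINS OF (MSP) AS A HYPOTHESIS (honest; this SHARPENS AND PARTLY WITHDRAWS module 12's header prose).  The canonical rates `τ_k` decay for TWO separate
reasons: the factor `G^{−k}` (generation 3's crude domination LETTERS — a worst-case bound, no cancellation inside the block averages) and the factor
`1∕((k+1)(k+2))` (ONE joint tilt budget: every level is charged to the SAME level-0 carrier and to ONE rung-0 chessboard bound).  A level-UNIFORM rate for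
all levels at once — what a summable `W_K` is counted from — calls (along the exponential-moment road) for BOTH level-uniform one-level letters AND a
PER-LEVEL budget, i.e. a joint exponential moment that FACTORISES scale by scale (`∫exp(β·Σ_k t_k X_k) dμ_β ≤ Π_k e^{c·t_k·#Y_k}` for `t_k ≤ a₀` EACH, not
`Σ_k G^k t_k ≤ a₀`): quasi-independence of the fluctuation fields across block-averaging scales, together with running-coupling-only one-level constants —
both outputs of Bałaban's inductive small-field analysis, print's KIND [Balaban1989LargeFieldII] (1.79) p. 383.  So: the product SHAPE of (MSP) is
elementary by value (modules 12–14); the UNIFORM product is an RG statement, and for it generation 6's caution (b′) STANDS — module 12's header sentence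
«NOT a statement about independence of large-field events across scales» is too strong and is withdrawn here.

HONEST FRAMING.  Count-neutral kernel theorems with LETTER-BASED, LEVEL-DEPENDENT constants (`τ_k ~ (A·M)^{−k}`, `v_k ~ M^k`): NOT summable along a renewal
chain as they stand; the located wall of NE7b in the fourth currency = level-uniform `τ`, `v` (running-coupling-only constants: Bałaban's inductive small-field
analysis, print's KIND [Balaban1989LargeFieldII] (1.79) p. 383 — NOT print's statement, NOT in the tree).  Residual binders as in modules 9–11 (the two
ζ-laws, (O4) measurability of the label weights, the per-cube regularity letters, disjoint letter regions).  Nothing of Bałaban's is asserted; NE7b NOT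
PRINTED ∕ NOT PROVED; the (α)-instance 0∕1; N20 NOT discharged (typed 28∕28, discharged count untouched); one finite four-torus programme at fixed `ε` — NOT
ℝ⁴, NOT infinite volume, NOT OS, NOT a mass gap, NOT Clay.  References (LOCATORS only; no decl carries a cite tag): T. Bałaban, CMP **119** (1988) 243–285
[Balaban1988Convergent] ((3.1)–(3.5) pp. 264–265); CMP **122** (1989) 175–202 [Balaban1989LargeFieldI] ((0.1) p. 175); CMP **122** (1989) 355–392
[Balaban1989LargeFieldII] ((1.79)–(1.89) pp. 383–387).
-/

set_option autoImplicit false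

noncomputable section

open scoped BigOperators

namespace Summit.QuantumFields.YangMills.BalabanUVNodes.N20ByValueMultiscaleCells

open MeasureTheory
open Literature.MathematicalPhysics.QuantumFieldTheory.Balaban1983to89
open Literature.MathematicalPhysics.QuantumFieldTheory.Balaban1983to89.T4Continuum
open Literature.MathematicalPhysics.QuantumFieldTheory.Balaban1983to89.Node00
open Summit.QuantumFields.BalabanUV.T4Continuum.B16HistoryReprChain
open Summit.QuantumFields.BalabanUV.T4Continuum.NE7b.PrefixExtraction (admS)
open Summit.QuantumFields.BalabanUV.T4Continuum.ShellMeasureAverageIterate (iterMap)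
open Summit.QuantumFields.YangMills.BalabanUVNodes.N20LCSLabelTower
open Summit.QuantumFields.YangMills.BalabanUVNodes.N20ByValueMultiscalePeierls (gibbsMeasure_multiLevel_largeField_dist1_le_prod)
open Summit.QuantumFields.YangMills.BalabanUVNodes.N20ByValueLabelTowerPinned
  (sum_admS_integral_labelTower_le_gibbsReal_mul iterMap_avOfRecord_eq)

/-! ## §0 Weighted one-witness-per-cell counting -/

section Counting

variable {Ω : Type*} [MeasurableSpace Ω] {μ : Measure Ω} [IsFiniteMeasure μ]

/-- ★ **WEIGHTED ONE-WITNESS-PER-CELL COUNTING** (generation 3's `N20LCSAvgCellPeierls.measureReal_forall_exists_le_pow` with per-witness weights): events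
`E p` whose simultaneous realisation on any sub-family `Y` of the cells' union costs `≤ Π_{p∈Y} w p` (`w ≥ 0`), pairwise disjoint cells `cells c`
(`c ∈ 𝒞`) of sizes `≤ m c` with per-cell majorants `w p ≤ W c` (`p ∈ cells c`, `W c ≥ 0`): then
`μ{ω | ∀ c ∈ 𝒞, ∃ p ∈ cells c, ω ∈ E p} ≤ Π_{c∈𝒞} (m c · W c)` (union over the `Π_c #cells c` choice functions; each realises `#𝒞` distinct witnesses).
[folklore] -/
theorem measureReal_forall_exists_le_prod {κ π : Type*} [DecidableEq κ] [DecidableEq π] (E : π → Set Ω) (𝒞 : Finset κ)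
    (cells : κ → Finset π) (m : κ → ℕ) (hm : ∀ c ∈ 𝒞, (cells c).card ≤ m c)
    (hdisj : ∀ c₁ ∈ 𝒞, ∀ c₂ ∈ 𝒞, c₁ ≠ c₂ → Disjoint (cells c₁) (cells c₂))
    (w : π → ℝ) (hw : ∀ p, 0 ≤ w p) (W : κ → ℝ) (hW0 : ∀ c ∈ 𝒞, 0 ≤ W c) (hW : ∀ c ∈ 𝒞, ∀ p ∈ cells c, w p ≤ W c)
    (hY : ∀ Y : Finset π, Y ⊆ 𝒞.biUnion cells → μ.real {ω | ∀ p ∈ Y, ω ∈ E p} ≤ ∏ p ∈ Y, w p) :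
    μ.real {ω | ∀ c ∈ 𝒞, ∃ p ∈ cells c, ω ∈ E p} ≤ ∏ c ∈ 𝒞, ((m c : ℝ) * W c) := by
  classical
  set F := 𝒞.pi cells with hF
  let A : ((c : κ) → c ∈ 𝒞 → π) → Set Ω := fun f => {ω | ∀ (c : κ) (hc : c ∈ 𝒞), ω ∈ E (f c hc)}
  -- the event lies in the union of the `A f`
  have hsub : {ω | ∀ c ∈ 𝒞, ∃ p ∈ cells c, ω ∈ E p} ⊆ ⋃ f ∈ F, A f := by
    intro ω hω
    simp only [Set.mem_setOf_eq] at hω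
    choose g hg hE using hω
    exact Set.mem_biUnion (x := g) (Finset.mem_coe.mpr (Finset.mem_pi.mpr fun c hc => hg c hc)) fun c hc => hE c hc
  -- each `A f` is a simultaneous realisation of `#𝒞` distinct witnesses, one in each cell
  have hA : ∀ f ∈ F, μ.real (A f) ≤ ∏ c ∈ 𝒞, W c := by
    intro f hf
    have hfmem : ∀ (c : κ) (hc : c ∈ 𝒞), f c hc ∈ cells c := fun c hc => Finset.mem_pi.mp hf c hc
    set Y : Finset π := 𝒞.attach.image (fun c => f c.1 c.2) with hYdef
    have hAY : A f ⊆ {ω | ∀ p ∈ Y, ω ∈ E p} := by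
      intro ω hω p hp
      obtain ⟨c, -, rfl⟩ := Finset.mem_image.mp hp
      exact hω c.1 c.2
    have hYsub : Y ⊆ 𝒞.biUnion cells := by
      intro p hp
      obtain ⟨c, -, rfl⟩ := Finset.mem_image.mp hp
      exact Finset.mem_biUnion.mpr ⟨c.1, c.2, hfmem c.1 c.2⟩
    have hinj : Set.InjOn (fun c : {c // c ∈ 𝒞} => f c.1 c.2) ↑(𝒞.attach) := by
      intro c₁ _ c₂ _ h
      by_contra hne
      have hne' : c₁.1 ≠ c₂.1 := fun h' => hne (Subtype.ext h')
      have hd := hdisj c₁.1 c₁.2 c₂.1 c₂.2 hne'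
      have h1 : f c₁.1 c₁.2 ∈ cells c₁.1 := hfmem _ _
      have h2 : f c₁.1 c₁.2 ∈ cells c₂.1 := by
        have := hfmem c₂.1 c₂.2
        simp only at h
        rwa [← h] at this
      exact Finset.disjoint_left.mp hd h1 h2
    calc μ.real (A f) ≤ μ.real {ω | ∀ p ∈ Y, ω ∈ E p} := measureReal_mono hAY (measure_ne_top μ _)
      _ ≤ ∏ p ∈ Y, w p := hY Y hYsub
      _ = ∏ c ∈ 𝒞.attach, w (f c.1 c.2) := by rw [hYdef, Finset.prod_image hinj]
      _ ≤ ∏ c ∈ 𝒞.attach, W c.1 :=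
          Finset.prod_le_prod (fun c _ => hw _) fun c _ => hW c.1 c.2 _ (hfmem c.1 c.2)
      _ = ∏ c ∈ 𝒞, W c := Finset.prod_attach 𝒞 W
  -- the number of choice functions
  have hFcard : (F.card : ℝ) ≤ ∏ c ∈ 𝒞, (m c : ℝ) := by
    have h : F.card ≤ ∏ c ∈ 𝒞, m c := by
      rw [hF, Finset.card_pi]
      exact Finset.prod_le_prod (fun c _ => Nat.zero_le _) hm
    exact_mod_cast h
  calc μ.real {ω | ∀ c ∈ 𝒞, ∃ p ∈ cells c, ω ∈ E p} ≤ μ.real (⋃ f ∈ F, A f) := measureReal_mono hsub (measure_ne_top μ _)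
    _ ≤ ∑ f ∈ F, μ.real (A f) := measureReal_biUnion_finset_le _ _
    _ ≤ ∑ _f ∈ F, ∏ c ∈ 𝒞, W c := Finset.sum_le_sum hA
    _ = F.card * ∏ c ∈ 𝒞, W c := by rw [Finset.sum_const, nsmul_eq_mul]
    _ ≤ (∏ c ∈ 𝒞, (m c : ℝ)) * ∏ c ∈ 𝒞, W c :=
        mul_le_mul_of_nonneg_right hFcard (Finset.prod_nonneg fun c hc => hW0 c hc)
    _ = ∏ c ∈ 𝒞, ((m c : ℝ) * W c) := by rw [← Finset.prod_mul_distrib]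

end Counting

/-! ## §1 Cells at every level, on the bare field -/

section Cells

/-- ★★★ **MULTISCALE CELLS-PEIERLS ON THE BARE FIELD — ONE FULL FACTOR PER PINNED CELL OF EVERY LEVEL.**  With module 13's rates `τ_k > 0` and volume
letters `v_k ≥ 0` (functions of `N`, `L`, `k` only): for every `d = 4` parameter set `P` (`P.L = L`), `K ≤ m + K_P`, `β ≥ 4N`, thresholds `ε_k ≥ 0`, and
every finite family of pins `c ∈ 𝒞` with levels `ℓ c ≤ K`, witness sets `cells c ⊆ Plaq P (ℓ c)` of size `≤ m_{ℓ c}`, pairwise disjoint as subsets of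
`Σ k, Plaq P k` (disjoint within each level; pins at different levels never collide),
  `μ_β{U | ∀ c ∈ 𝒞, ∃ p ∈ cells c, ε_{ℓ c} ≤ |Ū^{ℓ c}U(∂p) − 1|} ≤ Π_{c∈𝒞} m_{ℓ c}·(e^{v_{ℓ c}}·e^{−τ_{ℓ c} β ε_{ℓ c}²∕(2N)})`
(§0 with witnesses in `Σ k, Plaq P k` weighted by their level; the cost of a sub-family is module 13 §3 on its level-indexed traces, re-indexed by
`Finset.prod_sigma`).  The (MSP) SHAPE of module 11 §3, by value, with level-dependent letters. [folklore] -/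
theorem gibbsMeasure_multiLevel_largeFieldCells_dist1_le_prod (N : ℕ) [NeZero N] (L : ℕ) :
    ∃ τ : ℕ → ℝ, (∀ k, 0 < τ k) ∧ ∃ v : ℕ → ℝ, (∀ k, 0 ≤ v k) ∧ ∀ (P : Params), P.d = 4 → P.L = L → ∀ (K : ℕ), K ≤ P.m + P.K →
      ∀ (β : ℝ), 4 * N ≤ β → ∀ (ε : ℕ → ℝ), (∀ k, 0 ≤ ε k) →
      ∀ {κ : Type*} (𝒞 : Finset κ) (ℓ : κ → ℕ) (cells : (c : κ) → Finset (Plaq P (ℓ c))) (m : ℕ → ℕ),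
        (∀ c ∈ 𝒞, ℓ c ≤ K) → (∀ c ∈ 𝒞, (cells c).card ≤ m (ℓ c)) →
        (∀ c₁ ∈ 𝒞, ∀ c₂ ∈ 𝒞, c₁ ≠ c₂ →
          Disjoint ((cells c₁).map (Function.Embedding.sigmaMk (β := fun k => Plaq P k) (ℓ c₁)))
            ((cells c₂).map (Function.Embedding.sigmaMk (β := fun k => Plaq P k) (ℓ c₂)))) →
        (T4GenFunBounds.gibbsMeasure P β : Measure (GaugeField P 0 (Matrix.specialUnitaryGroup (Fin N) ℂ))).real
            {U | ∀ c ∈ 𝒞, ∃ p ∈ cells c, ε (ℓ c) ≤ dist1 (GaugeField.plaqHol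
              (Averaging.iter (fun _ => BlockAveraging.blockAvg (ExpMeanLog.expMeanLogSU (n := Fin N))) (ℓ c) U) p)} ≤
          ∏ c ∈ 𝒞, ((m (ℓ c) : ℝ) * (Real.exp (v (ℓ c)) *
            Real.exp (-(τ (ℓ c) * β * (ε (ℓ c) ^ 2 / (2 * (Fintype.card (Fin N) : ℝ))))))) := by
  obtain ⟨τ, hτ, v, hv, h⟩ := gibbsMeasure_multiLevel_largeField_dist1_le_prod N L
  refine ⟨τ, hτ, v, hv, fun P hd hL K hK β hβ ε hε κ 𝒞 ℓ cells m hℓ hm hdisj => ?_⟩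
  classical
  have hNpos : (0 : ℝ) < N := Nat.cast_pos.mpr (Nat.pos_of_ne_zero (NeZero.ne N))
  have hβ0 : 0 ≤ β := le_trans (by positivity) hβ
  haveI := T4GenFunBounds.isProbabilityMeasure_gibbsMeasure (G := Matrix.specialUnitaryGroup (Fin N) ℂ) P hβ0
  -- the per-level factor, the witnesses tagged by their level, the events
  set W : ℕ → ℝ := fun k => Real.exp (v k) * Real.exp (-(τ k * β * (ε k ^ 2 / (2 * (Fintype.card (Fin N) : ℝ))))) with hW
  have hW0 : ∀ k, 0 ≤ W k := fun k => by rw [hW]; positivity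
  let Ev : (Σ k, Plaq P k) → Set (GaugeField P 0 (Matrix.specialUnitaryGroup (Fin N) ℂ)) := fun q =>
    {U | ε q.1 ≤ dist1 (GaugeField.plaqHol
      (Averaging.iter (fun _ => BlockAveraging.blockAvg (ExpMeanLog.expMeanLogSU (n := Fin N))) q.1 U) q.2)}
  let cellsS : κ → Finset (Σ k, Plaq P k) := fun c =>
    (cells c).map (Function.Embedding.sigmaMk (β := fun k => Plaq P k) (ℓ c))
  have hev : {U : GaugeField P 0 (Matrix.specialUnitaryGroup (Fin N) ℂ) | ∀ c ∈ 𝒞, ∃ p ∈ cells c, ε (ℓ c) ≤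
        dist1 (GaugeField.plaqHol
          (Averaging.iter (fun _ => BlockAveraging.blockAvg (ExpMeanLog.expMeanLogSU (n := Fin N))) (ℓ c) U) p)} ⊆
      {U | ∀ c ∈ 𝒞, ∃ q ∈ cellsS c, U ∈ Ev q} := by
    intro U hU c hc
    obtain ⟨p, hp, hle⟩ := hU c hc
    exact ⟨⟨ℓ c, p⟩, Finset.mem_map_of_mem _ hp, hle⟩
  refine (measureReal_mono hev (measure_ne_top _ _)).trans ?_
  refine measureReal_forall_exists_le_prod Ev 𝒞 cellsS (fun c => m (ℓ c)) (fun c hc => ?_) hdisj (fun q => W q.1)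
    (fun q => hW0 q.1) (fun c => W (ℓ c)) (fun c _ => hW0 (ℓ c)) (fun c _ q hq => ?_) (fun Yσ hYσ => ?_)
  · rw [Finset.card_map]; exact hm c hc
  · obtain ⟨p, -, rfl⟩ := Finset.mem_map.mp hq
    exact le_rfl
  · -- a sub-family of the cells' union: levels `≤ K`; read it level by level
    have hlev : ∀ q ∈ Yσ, q.1 ≤ K := by
      intro q hq
      obtain ⟨c, hc, hq'⟩ := Finset.mem_biUnion.mp (hYσ hq)
      obtain ⟨p, -, rfl⟩ := Finset.mem_map.mp hq'
      exact hℓ c hc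
    set Y : (k : ℕ) → Finset (Plaq P k) := fun k => Finset.univ.filter (fun p => (⟨k, p⟩ : Σ k, Plaq P k) ∈ Yσ) with hYdef
    have hmemY : ∀ (k : ℕ) (p : Plaq P k), p ∈ Y k ↔ (⟨k, p⟩ : Σ k, Plaq P k) ∈ Yσ := fun k p => by
      rw [hYdef]; simp
    have hYσ_eq : Yσ = (Finset.range (K + 1)).sigma Y := by
      ext ⟨k, p⟩
      rw [Finset.mem_sigma, Finset.mem_range, hmemY]
      exact ⟨fun hq => ⟨Nat.lt_succ_of_le (hlev _ hq), hq⟩, fun hq => hq.2⟩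
    have hsub : {U : GaugeField P 0 (Matrix.specialUnitaryGroup (Fin N) ℂ) | ∀ q ∈ Yσ, U ∈ Ev q} ⊆
        {U | ∀ k ∈ Finset.range (K + 1), ∀ p ∈ Y k, ε k ≤ dist1 (GaugeField.plaqHol
          (Averaging.iter (fun _ => BlockAveraging.blockAvg (ExpMeanLog.expMeanLogSU (n := Fin N))) k U) p)} :=
      fun U hU k _ p hp => hU _ ((hmemY k p).mp hp)
    calc (T4GenFunBounds.gibbsMeasure P β : Measure (GaugeField P 0 (Matrix.specialUnitaryGroup (Fin N) ℂ))).real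
            {U | ∀ q ∈ Yσ, U ∈ Ev q}
        ≤ (T4GenFunBounds.gibbsMeasure P β : Measure (GaugeField P 0 (Matrix.specialUnitaryGroup (Fin N) ℂ))).real
            {U | ∀ k ∈ Finset.range (K + 1), ∀ p ∈ Y k, ε k ≤ dist1 (GaugeField.plaqHol
              (Averaging.iter (fun _ => BlockAveraging.blockAvg (ExpMeanLog.expMeanLogSU (n := Fin N))) k U) p)} :=
          measureReal_mono hsub (measure_ne_top _ _)
      _ ≤ ∏ k ∈ Finset.range (K + 1), W k ^ (Y k).card := by
          have := h P hd hL K hK β hβ ε hε Y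
          simpa only [hW] using this
      _ = ∏ q ∈ Yσ, W q.1 := by
          rw [hYσ_eq, Finset.prod_sigma]
          exact Finset.prod_congr rfl fun k _ => by simp only [Finset.prod_const]

end Cells

/-! ## §2 On Bałaban's label tower of record: any finite set of pinned levels, the full product, unconditionally -/

section LabelTower

variable (F : T4Family) (N : ℕ) [NeZero N] (ν : Stage7Numerics) (M : ℕ) (p : B12.RunParams) (g : ℕ → ℝ)

open Classical in
/-- ★★★ **KEYS PINNING CUBES AT ANY FINITE SET OF LEVELS ON BAŁABAN's LABEL TOWER, BY VALUE — THE FULL PRODUCT, UNCONDITIONALLY.**  For every `N ≥ 1`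
and torus family `F` there are rates `τ_k > 0` and volume letters `v_k ≥ 0` (module 13's, functions of `N`, `F.L`, `k`) such that: for `g₀⁻² ≥ 4N`, every
`E₀`, `A₁`, every `ζ` obeying the two displayed laws with (O4)-measurable label weights, every finite set `J` of pinned levels `j < K_P` with families
`D j` of χ_{j+1}-cubes, regularity letters on pairwise disjoint regions `R j c` of `≤ m_j` level-`(j+1)` plaquettes, thresholds `ε_j ≥ 0`, every cutoff
`K′` and every label-family pattern `E` pinning `D j` at the levels `j ∈ J` (`t ∈ E j h → D j ⊆ P(t)`) and free elsewhere (`E j h = univ`, `j ∉ J`):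
`Σ_{h ∈ admS (labelTowerOfRecord A₁ ζ) (labelPattern E) K′} ∫ eterm ρ₀ K′ h dμ_{K′} ≤
   (Π_{j ∈ J, j < K′} (m_j·e^{v_{j+1}}·e^{−τ_{j+1} g₀⁻² ε_j²∕(2N)})^{#D_j}) · ∫ ρ₀ dU₀`
— ONE full Peierls factor per pinned cube of EVERY pinned level: module 11 §2 without the `1∕#J`-th root, module 11 §3's conclusion with its (MSP)
hypothesis discharged in LEVEL-DEPENDENT form (module 9's reduction `sum_admS_integral_labelTower_le_gibbsReal_mul` + §1 with the pins `(j, c)`,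
`c ∈ D j`, at level `j + 1`).  Honest: `τ_{j+1} ~ (A·M)^{−(j+1)}`, `v_{j+1} ~ M^{j+1}` — the wall is their level-uniformity. [folklore] -/
theorem sum_admS_integral_le_labelTower_allLevels_byValue :
    ∃ τ : ℕ → ℝ, (∀ k, 0 < τ k) ∧ ∃ v : ℕ → ℝ, (∀ k, 0 ≤ v k) ∧ ∀ (g₀ E₀ A₁ : ℝ), 4 * N ≤ g₀⁻¹ ^ 2 →
      ∀ {ζ : ZetaOfRecord F N ν M}, IsZetaUnity F N ν M ζ → IsZetaAbsLeOne F N ν M ζ →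
      (∀ (k : ℕ) (s : SeqOfRecord F ν M g p.K k) (t : LbOfRecord F ν p g k),
        Measurable fun z : cfgOfRecord F N p.K (k + 1) × cfgOfRecord F N p.K k => ωOfRecord F N ν M p g k A₁ ζ s t z.2 z.1) →
      ∀ (J : Finset ℕ), (∀ j ∈ J, j < p.K) →
      ∀ (D : (j : ℕ) → Finset (Iχ F ν p g j)) (R : (j : ℕ) → Iχ F ν p g j → Finset (Plaq (F.P p.K) (j + 1))) (m : ℕ → ℕ) (ε : ℕ → ℝ),
        (∀ j ∈ J, 0 ≤ ε j) → (∀ j ∈ J, ∀ c ∈ D j, (R j c).card ≤ m j) →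
        (∀ j ∈ J, ∀ c₁ ∈ D j, ∀ c₂ ∈ D j, c₁ ≠ c₂ → Disjoint (R j c₁) (R j c₂)) →
        (∀ j ∈ J, ∀ c ∈ D j, ∀ V' : GaugeField (F.P p.K) (j + 1) (SU N),
          (∀ p' ∈ R j c, dist1 (GaugeField.plaqHol V' p') < ε j) → chiFactor F N ν p g j c V' = 1) →
      ∀ (K' : ℕ) (E : (j : ℕ) → (Fin j → LabelPat F ν p g) → Finset (LbOfRecord F ν p g j)),
        (∀ j ∈ J, ∀ h t, t ∈ E j h → D j ⊆ t.1) → (∀ j, j ∉ J → ∀ h, E j h = Finset.univ) →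
        ∑ h ∈ admS (labelTowerOfRecord F N ν M p g A₁ ζ) (labelPattern F ν p g E) K',
            ∫ x, (labelTowerOfRecord F N ν M p g A₁ ζ).eterm (rhoZeroOfRecord F N p.K g₀ E₀) K' h x ∂(lawOfRecord F N p.K K') ≤
          (∏ j ∈ J.filter (· < K'), ((m j : ℝ) * (Real.exp (v (j + 1)) *
              Real.exp (-(τ (j + 1) * g₀⁻¹ ^ 2 * (ε j ^ 2 / (2 * (Fintype.card (Fin N) : ℝ))))))) ^ (D j).card) *
            ∫ U, rhoZeroOfRecord F N p.K g₀ E₀ U ∂(fieldMeasure (F.P p.K) 0 (SU N)) := by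
  obtain ⟨τ, hτ, v, hv, h⟩ := gibbsMeasure_multiLevel_largeFieldCells_dist1_le_prod N F.L
  refine ⟨τ, hτ, v, hv, fun g₀ E₀ A₁ hg ζ hζu hζ hω J hJK D R m ε hε hm hdisj hreg K' E hEpin hEfree => ?_⟩
  have key := sum_admS_integral_labelTower_le_gibbsReal_mul F N ν M p g g₀ E₀ A₁ hζu hζ hω J D R ε hreg E hEpin hEfree K'
  refine key.trans (mul_le_mul_of_nonneg_right ?_ (integral_nonneg fun U => (rhoZeroOfRecord_pos F N p.K g₀ E₀ U).le))
  haveI := T4GenFunBounds.isProbabilityMeasure_gibbsMeasure (G := SU N) (F.P p.K) (sq_nonneg g₀⁻¹)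
  -- the pins `(j, c)`, `j ∈ J`, `j < K′`, `c ∈ D j`, at level `j + 1`; thresholds re-indexed by level
  set 𝒞 : Finset (Σ j, Iχ F ν p g j) := (J.filter (· < K')).sigma D with h𝒞
  set ε' : ℕ → ℝ := fun k => max 0 (ε (k - 1)) with hε'
  have hε'0 : ∀ k, 0 ≤ ε' k := fun k => le_max_left _ _
  have hε'J : ∀ j ∈ J, ε' (j + 1) = ε j := fun j hj => by
    rw [hε']; simp only [Nat.add_sub_cancel]; exact max_eq_right (hε j hj)
  have hmem𝒞 : ∀ x ∈ 𝒞, x.1 ∈ J ∧ x.1 < K' ∧ x.2 ∈ D x.1 := fun x hx => by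
    rw [h𝒞, Finset.mem_sigma, Finset.mem_filter] at hx
    exact ⟨hx.1.1, hx.1.2, hx.2⟩
  have hmK : p.K ≤ (F.P p.K).m + (F.P p.K).K := by simp only [T4Family.P_m, T4Family.P_K]; omega
  have hcells := h (F.P p.K) (T4Family.P_d F p.K) (T4Family.P_L F p.K) p.K hmK (g₀⁻¹ ^ 2) hg ε' hε'0 𝒞
    (fun x => x.1 + 1) (fun x => R x.1 x.2) (fun k => m (k - 1))
    (fun x hx => Nat.succ_le_of_lt (hJK x.1 (hmem𝒞 x hx).1))
    (fun x hx => by simpa only [Nat.add_sub_cancel] using hm x.1 (hmem𝒞 x hx).1 x.2 (hmem𝒞 x hx).2.2)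
    (fun x₁ hx₁ x₂ hx₂ hne => ?_)
  · -- event inclusion and the product, pin by pin
    have hsub : {U : cfgOfRecord F N p.K 0 | ∀ j ∈ J, j < K' → ∀ c ∈ D j, ∃ p' ∈ R j c,
          ε j ≤ dist1 (GaugeField.plaqHol (iterMap (fun i => (avOfRecord F N p.K i).avg) (j + 1) U) p')} ⊆
        {U | ∀ x ∈ 𝒞, ∃ p' ∈ R x.1 x.2, ε' (x.1 + 1) ≤ dist1 (GaugeField.plaqHol
          (Averaging.iter (fun _ => BlockAveraging.blockAvg (ExpMeanLog.expMeanLogSU (n := Fin N))) (x.1 + 1) U) p')} := by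
      intro U hU x hx
      obtain ⟨hj, hjK, hc⟩ := hmem𝒞 x hx
      obtain ⟨p', hp', hle⟩ := hU x.1 hj hjK x.2 hc
      refine ⟨p', hp', ?_⟩
      rw [hε'J x.1 hj, ← iterMap_avOfRecord_eq]
      exact hle
    refine (measureReal_mono hsub (measure_ne_top _ _)).trans (hcells.trans (le_of_eq ?_))
    rw [h𝒞, Finset.prod_sigma]
    refine Finset.prod_congr rfl fun j hj => ?_
    have hjJ : j ∈ J := (Finset.mem_filter.mp hj).1
    simp only [Finset.prod_const, Nat.add_sub_cancel, hε'J j hjJ]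
  · -- pins are disjoint inside `Σ k, Plaq P k`: distinct levels never collide, equal levels by `hdisj`
    obtain ⟨j₁, c₁⟩ := x₁
    obtain ⟨j₂, c₂⟩ := x₂
    obtain ⟨hj₁, -, hc₁⟩ := hmem𝒞 _ hx₁
    obtain ⟨-, -, hc₂⟩ := hmem𝒞 _ hx₂
    by_cases hj : j₁ = j₂
    · subst hj
      have hne' : c₁ ≠ c₂ := fun hc => hne (by rw [hc])
      exact (Finset.disjoint_map _).mpr (hdisj j₁ hj₁ c₁ hc₁ c₂ hc₂ hne')
    · refine Finset.disjoint_left.mpr fun q hq₁ hq₂ => hj ?_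
      obtain ⟨p₁, -, rfl⟩ := Finset.mem_map.mp hq₁
      obtain ⟨p₂, -, hq⟩ := Finset.mem_map.mp hq₂
      have := congrArg Sigma.fst hq
      simp only [Function.Embedding.sigmaMk_apply] at this
      omega

end LabelTower

end Summit.QuantumFields.YangMills.BalabanUVNodes.N20ByValueMultiscaleCells

end
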